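import Summits.CriticalPhenomena.PercolationContinuityZ3.Theorems.PercNearOneGluingNoHeavyLowerTailSunflowerSafeTransport
import Summits.CriticalPhenomena.PercolationContinuityZ3.Theorems.PercNearOneGluingNoHeavyLowerTailSunflowerBernsteinPathFive
import Summits.CriticalPhenomena.PercolationContinuityZ3.Theorems.PercNearOneGluingNoHeavyLowerTailSunflowerBernsteinPentagon
import Summits.CriticalPhenomena.PercolationContinuityZ3.Theorems.PercNearOneGluingNoHeavyLowerTailSunflowerCoverCounterexample
import HarnessLib

/-!
# `NoHeavyLowerTail` (crux stmt-CriticalPhenomena-4575), abstract sunflower cubic: THE CERTIFIED CORES IN AN ARBITRARY CUBE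

Support file (seat `prim-ineq-prove-1` gen 38; `--supports stmt-CriticalPhenomena-4575`).  No `sorry`, no named facts.
Memo: run/shared/lean/prim/prim-ineq-prove-1/FINDING-BERNSTEIN-prove1-g38.md §5.

The A-safety theorems `PathFive.safe_core`, `Pentagon.safe_core` (…SunflowerBernsteinPathFive / …Pentagon, every `p`) and
`Fan.safe_core` (…SunflowerCoverCounterexample, `p = 1/32`) are stated on the cubes `Fin 5` / `Fin 4`.  By the transport theorem
`safe_cylEv` (…SunflowerSafeTransport) they hold for the corresponding CYLINDER cores in any finite cube `Set ι` along any embedding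
`f` of the points: `PathFive.safe_cylEv`, `Pentagon.safe_cylEv` (every `p`), `Fan.safe_cylEv` (every `p` whose pull-back along `f`
is the uniform `1/32`).  These are the forms consumed by the calculus (`safe_inter`, `safe_union_of_gsafe`, the rows `…_of_safe`).
-/

noncomputable section

namespace Summit.CriticalPhenomena.PercolationContinuityZ3.Theorems.SunflowerPartition

namespace SafeCalc

open Literature.Probability.LatticeModels Literature.Probability.Percolation

variable {ι : Type*} [Fintype ι] [DecidableEq ι]

/-- **The path core `P₅` is safe in any ambient cube**, along any embedding of its five points, for every product measure.
[this work] -/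
theorem PathFive.safe_cylEv (p : ι → unitInterval) (f : Fin 5 ↪ ι) : Safe p (cylEv f PathFive.core) :=
  SafeCalc.safe_cylEv p f (PathFive.safe_core fun i => p (f i))

/-- **The pentagon core `C₅` is safe in any ambient cube**, along any embedding of its five points, for every product measure.
[this work] -/
theorem Pentagon.safe_cylEv (p : ι → unitInterval) (f : Fin 5 ↪ ι) : Safe p (cylEv f Pentagon.core) :=
  SafeCalc.safe_cylEv p f (Pentagon.safe_core fun i => p (f i))

/-- The fan core is safe in any ambient cube along any embedding whose pulled-back parameters are the uniform `1/32`. [this work] -/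
theorem Fan.safe_cylEv (p : ι → unitInterval) (f : Fin 4 ↪ ι) (hp : (fun i => p (f i)) = Fan.p32) :
    Safe p (cylEv f Fan.core) :=
  SafeCalc.safe_cylEv p f (hp ▸ Fan.safe_core)

end SafeCalc

end Summit.CriticalPhenomena.PercolationContinuityZ3.Theorems.SunflowerPartition
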